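/-
Copyright (c) 2026 the pub-hodgecm-mathlib formalisation cell (harness21).  Prover seat hodgecm-mathlib-LH4-p08 (g9), req620 Track A «(D-RAM) FOUR-FRAME» squad, helper lane
on h413 = stmt-HodgeConjecture-24833 (count-neutral).  STAGE-1b, row (2), type-U lane of the (LAW) END (second hand to LH4-p07 (g9)).  2026-09-04.
-/
import Summits.HodgeConjecture.HodgeConjecture.Theorems.F0P3cDyRamLevelsCensusLawArithUnr   -- ★ p860134 (this lineage, g8): `law_arith_unr` (abstract exponents)
import HarnessLib

/-!
# Crux `H413`, line LH4 «(D-RAM) FOUR-FRAME» — STAGE-1b, row (2): (LAW-arith)-Unr♯ «THE CLOSING ARITHMETIC OF A GENERIC LEVEL PIECE, TYPE U»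
# `(q − 1)·q^{ks}·V_U(m − a, jλ − a, m + jλ − b) = q^m·((q + 1)·q^{jλ∕2} − 2·q^T)` under the (ks, T) rule; and the inert `ℤ` bottom

Cell `hodgecm-mathlib` (D-0151), FLOOR 0, crux item H413 = `stmt-HodgeConjecture-24833`, route of record `HCCMUnconditional`; squad F0∕P3c∕LH4 (req618∕req620); helper lane
`--supports stmt-HodgeConjecture-24833 --as helper` (count-neutral).  THEOREMS ONLY (no `def`, no instance, no notation, no `sorry`); pure `ℕ`∕`ℚ`∕`ℤ` bookkeeping.

THE OBJECT.  The type-U level socket `levelsCensusA` (this seat, SIG `SIG-levelsCensusA.skel.v1` 42046bc8; LH4-p07 (g9)'s `levelsCensusB` template fc50d796 → v2) is GENERIC in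
the piece `(a, b, ks, T)` under LH4-p07 (g9)'s LAW-INSTANCES rule `2ks + 2⌊(d + a%2)∕2⌋ = a + a%2 + b + b%2`, `a` even ⇒ `T + a = ks + (d − d%2)`, `a` odd ⇒
`T + a + 1 = ks + (d − d%2) + 2(d%2)` (rows of record sq ∕ lev_lo ∕ lev_hi ∕ T₊-lo ∕ T₊-hi are instances).  ★ p860134 (g8) typed the closing arithmetic for the four
instance rows; THIS FILE types it for the generic piece — the type-U twin of LH4-p07 (g9)'s `F0P3cDyRamLevelsLawExponents` ∘ ★ p859957 `law_arith`:
* §1 `exponents_unr_std_one ∕ _std_two ∕ _flip_one ∕ _flip_two` — the exponent side-goals of ★ `law_arith_unr` with explicit parity witnesses (lane = parity of `a`;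
  branch = ★ T5s-U's realizability branch `m ≡ d, m + d ≤ jλ` or `m = jλ − d + 1`), from `m₁ + a = m`, `jλ₁ + a = jλ`, `C + b = m + jλ`, `d + 2a ≤ b + 1`, `b ≤ m + a`;
* §2 **`law_arith_unr_std`** (`a` even, ★ p860069's even value) and **`law_arith_unr_flip`** (`a` odd, flipped value):
  `(q − 1)·q^{ks}·V_U(m₁, jλ₁, C) = q^m·((q + 1)·q^{jλ∕2} − 2·q^T)` on both branches (exactly one cut top band fires on each);
* §3 **`levels_bottom_arith_inert`** — the `ℤ` last step with the INERT H-side law `(q − 1)(#Fix + d%2) + 2 = (q + 1)q^{jλ∕2}` (type U = type (A) of the H-side organ).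
EVIDENCE (python twin `F0/P3c/LH4/LH4-p08/g9/lawcheck_unr_generic.v1.LH4p08g9.py`): §2 on exact rationals for q ≤ 4, 2 ≤ d ≤ 6, all admissible `(a, b, ks, T)`, both
branches, m, jλ < 40 — 69 468 cases, 0 bad.
HONEST LABEL.  Count-neutral arithmetic; no frame, no CM place, no law asserted; `HC_CM` is proved only modulo the 7 printed citations (2 remaining named inputs: hLiu418 =
`stmt-HodgeConjecture-24832`, h413 = `stmt-HodgeConjecture-24833`) until rung 0 closes.

## References
* [Rogawski1990] J. D. Rogawski, *Automorphic Representations of Unitary Groups in Three Variables*, Ann. of Math. Stud. 123 (1990): §4.9 Prop. 4.9.1 (b) p. 55 (the transfer identity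
  whose constants these exponents feed).
* [Kottwitz1986BaseChangeUnits] R. E. Kottwitz, *Base change for unit elements of Hecke algebras*, Compositio Math. 60 (1986): §1 pp. 240–241 (lattice-count form of the sides).
* [Flicker1998UnitaryFL] Y. Z. Flicker, *Elementary proof of the fundamental lemma for a unitary group*, Canad. J. Math. 50 (1998): Prop. 7 p. 84 (the counting recursion).
* [LabesseLanglands1979] J.-P. Labesse, R. P. Langlands, *L-indistinguishability for SL(2)*, Canad. J. Math. 31 (1979): §2 pp. 8–10 (the inert torus count).
-/

set_option autoImplicit false

namespace Summit.HodgeConjecture.HodgeConjecture.Cruxes.H413.F0P3cDyRamLevelsCensusLawArithUnrGeneric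

open Finset
open Summit.HodgeConjecture.HodgeConjecture.Cruxes.H413.F0P3cDyRamLevelsCensusLawArithUnr (law_arith_unr)

/-! ## §1 Exponent bookkeeping (parity witnesses + `omega`) -/

set_option maxHeartbeats 800000 in
-- budget only: four parity cases × four `omega` calls over explicit witnesses (no search); default 200000 covers one case.
/-- **EXPONENT BOOKKEEPING, STANDARD LANE (`a` even), BRANCH `m ≡ d`, `m + d ≤ jλ`** (the ball's top band fires).  With `lo := (C + m₁ − jλ₁)∕2 + 1`,
`hi := (2m₁ + 1 − d)∕2 + 1`: `lo ≤ hi`, the top cancellation `m₁ + jλ₁∕2 = E₁ + (hi − lo)`, and the two exponent identities ★ `law_arith_unr` consumes at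
`(k, M, A, B, N, P) := (ks, m₁, jλ₁∕2, d − d%2, m, jλ∕2)`. [cite: Rogawski1990, §4.9 Prop. 4.9.1 (b) p. 55] -/
theorem exponents_unr_std_one {a b d ks T m jl m₁ jl₁ C : ℕ} (ha2 : a % 2 = 0) (hjl : jl % 2 = 0)
    (hab1 : d + 2 * a ≤ b + 1) (hd2 : 2 ≤ d)
    (hks : 2 * ks + 2 * ((d + a % 2) / 2) = a + a % 2 + (b + b % 2)) (hT : T + a = ks + (d - d % 2))
    (hme : m₁ + a = m) (hjle : jl₁ + a = jl) (hCb : C + b = m + jl) (hbm : b ≤ m + a)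
    (hpar : m₁ % 2 = d % 2) (hmd : m₁ + d ≤ jl₁) :
    (C + m₁ - jl₁) / 2 + 1 ≤ (2 * m₁ + 1 - d) / 2 + 1 ∧
      m₁ + jl₁ / 2 = (((C + m₁ - jl₁) / 2 + 1) + d + (jl₁ - m₁ - d) / 2 + m₁ / 2 - 1) + (((2 * m₁ + 1 - d) / 2 + 1) - ((C + m₁ - jl₁) / 2 + 1)) ∧
      ks + (m₁ + jl₁ / 2) = m + jl / 2 + (((2 * m₁ + 1 - d) / 2 + 1) - ((C + m₁ - jl₁) / 2 + 1)) ∧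
      ks + (m₁ + (d - d % 2)) = m + T := by
  rw [ha2] at hks
  obtain ⟨a2, rfl⟩ : ∃ a2, a = 2 * a2 := ⟨a / 2, by omega⟩
  obtain ⟨j2, rfl⟩ : ∃ j2, jl₁ = 2 * j2 := ⟨jl₁ / 2, by omega⟩
  rcases Nat.even_or_odd' d with ⟨d2, rfl | rfl⟩ <;> rcases Nat.even_or_odd' b with ⟨b2, rfl | rfl⟩
  · obtain ⟨m2, rfl⟩ : ∃ m2, m₁ = 2 * m2 := ⟨m₁ / 2, by omega⟩
    exact ⟨by omega, by omega, by omega, by omega⟩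
  · obtain ⟨m2, rfl⟩ : ∃ m2, m₁ = 2 * m2 := ⟨m₁ / 2, by omega⟩
    exact ⟨by omega, by omega, by omega, by omega⟩
  · obtain ⟨m2, rfl⟩ : ∃ m2, m₁ = 2 * m2 + 1 := ⟨m₁ / 2, by omega⟩
    exact ⟨by omega, by omega, by omega, by omega⟩
  · obtain ⟨m2, rfl⟩ : ∃ m2, m₁ = 2 * m2 + 1 := ⟨m₁ / 2, by omega⟩
    exact ⟨by omega, by omega, by omega, by omega⟩

set_option maxHeartbeats 800000 in
-- budget only: four parity cases × four `omega` calls over explicit witnesses (no search); default 200000 covers one case.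
/-- **EXPONENT BOOKKEEPING, STANDARD LANE, BRANCH `m = jλ − d + 1`** (the diagonal top band fires; `E₂ := lo + d + m₁ − m₁∕2 − 2`). [cite: Rogawski1990, §4.9 Prop. 4.9.1 (b) p. 55] -/
theorem exponents_unr_std_two {a b d ks T m jl m₁ jl₁ C : ℕ} (ha2 : a % 2 = 0) (hjl : jl % 2 = 0)
    (hab1 : d + 2 * a ≤ b + 1) (hd2 : 2 ≤ d)
    (hks : 2 * ks + 2 * ((d + a % 2) / 2) = a + a % 2 + (b + b % 2)) (hT : T + a = ks + (d - d % 2))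
    (hme : m₁ + a = m) (hjle : jl₁ + a = jl) (hCb : C + b = m + jl) (hbm : b ≤ m + a)
    (hmeq : m₁ = jl₁ - d + 1) (hdjl : d ≤ jl₁) :
    (C + m₁ - jl₁) / 2 + 1 ≤ (2 * m₁ + 1 - d) / 2 + 1 ∧
      m₁ + jl₁ / 2 = (((C + m₁ - jl₁) / 2 + 1) + d + m₁ - m₁ / 2 - 2) + (((2 * m₁ + 1 - d) / 2 + 1) - ((C + m₁ - jl₁) / 2 + 1)) ∧
      ks + (m₁ + jl₁ / 2) = m + jl / 2 + (((2 * m₁ + 1 - d) / 2 + 1) - ((C + m₁ - jl₁) / 2 + 1)) ∧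
      ks + (m₁ + (d - d % 2)) = m + T := by
  rw [ha2] at hks
  obtain ⟨a2, rfl⟩ : ∃ a2, a = 2 * a2 := ⟨a / 2, by omega⟩
  obtain ⟨j2, rfl⟩ : ∃ j2, jl₁ = 2 * j2 := ⟨jl₁ / 2, by omega⟩
  subst hmeq
  rcases Nat.even_or_odd' d with ⟨d2, rfl | rfl⟩ <;> rcases Nat.even_or_odd' b with ⟨b2, rfl | rfl⟩
  · exact ⟨by omega, by omega, by omega, by omega⟩
  · exact ⟨by omega, by omega, by omega, by omega⟩
  · exact ⟨by omega, by omega, by omega, by omega⟩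
  · exact ⟨by omega, by omega, by omega, by omega⟩

set_option maxHeartbeats 800000 in
-- budget only: four parity cases × four `omega` calls over explicit witnesses (no search); default 200000 covers one case.
/-- **EXPONENT BOOKKEEPING, FLIPPED LANE (`a` odd), BRANCH `m ≡ d`, `m + d ≤ jλ`** (★ p859860's flipped shapes `A = jλ₁∕2 + d%2`, `B = d − 1 + d%2`; rule
`T + a + 1 = ks + (d − d%2) + 2(d%2)`). [cite: Rogawski1990, §4.9 Prop. 4.9.1 (b) p. 55] -/
theorem exponents_unr_flip_one {a b d ks T m jl m₁ jl₁ C : ℕ} (ha2 : a % 2 = 1) (hjl : jl % 2 = 0)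
    (hab1 : d + 2 * a ≤ b + 1) (hd2 : 2 ≤ d)
    (hks : 2 * ks + 2 * ((d + a % 2) / 2) = a + a % 2 + (b + b % 2)) (hT : T + a + 1 = ks + (d - d % 2) + 2 * (d % 2))
    (hme : m₁ + a = m) (hjle : jl₁ + a = jl) (hCb : C + b = m + jl) (hbm : b ≤ m + a)
    (hpar : m₁ % 2 ≠ d % 2) (hmd : m₁ + d ≤ jl₁) :
    (C + m₁ - jl₁) / 2 + 1 ≤ (2 * m₁ + 1 - d) / 2 + 1 ∧
      m₁ + (jl₁ / 2 + d % 2) = (((C + m₁ - jl₁) / 2 + 1) + d + (jl₁ - m₁ - d) / 2 + m₁ / 2 - 1) + (((2 * m₁ + 1 - d) / 2 + 1) - ((C + m₁ - jl₁) / 2 + 1)) ∧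
      ks + (m₁ + (jl₁ / 2 + d % 2)) = m + jl / 2 + (((2 * m₁ + 1 - d) / 2 + 1) - ((C + m₁ - jl₁) / 2 + 1)) ∧
      ks + (m₁ + (d - 1 + d % 2)) = m + T := by
  rw [ha2] at hks
  obtain ⟨a2, rfl⟩ : ∃ a2, a = 2 * a2 + 1 := ⟨a / 2, by omega⟩
  obtain ⟨j2, rfl⟩ : ∃ j2, jl₁ = 2 * j2 + 1 := ⟨jl₁ / 2, by omega⟩
  rcases Nat.even_or_odd' d with ⟨d2, rfl | rfl⟩ <;> rcases Nat.even_or_odd' b with ⟨b2, rfl | rfl⟩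
  · obtain ⟨m2, rfl⟩ : ∃ m2, m₁ = 2 * m2 + 1 := ⟨m₁ / 2, by omega⟩
    exact ⟨by omega, by omega, by omega, by omega⟩
  · obtain ⟨m2, rfl⟩ : ∃ m2, m₁ = 2 * m2 + 1 := ⟨m₁ / 2, by omega⟩
    exact ⟨by omega, by omega, by omega, by omega⟩
  · obtain ⟨m2, rfl⟩ : ∃ m2, m₁ = 2 * m2 := ⟨m₁ / 2, by omega⟩
    exact ⟨by omega, by omega, by omega, by omega⟩
  · obtain ⟨m2, rfl⟩ : ∃ m2, m₁ = 2 * m2 := ⟨m₁ / 2, by omega⟩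
    exact ⟨by omega, by omega, by omega, by omega⟩

set_option maxHeartbeats 800000 in
-- budget only: four parity cases × four `omega` calls over explicit witnesses (no search); default 200000 covers one case.
/-- **EXPONENT BOOKKEEPING, FLIPPED LANE, BRANCH `m = jλ − d + 1`.** [cite: Rogawski1990, §4.9 Prop. 4.9.1 (b) p. 55] -/
theorem exponents_unr_flip_two {a b d ks T m jl m₁ jl₁ C : ℕ} (ha2 : a % 2 = 1) (hjl : jl % 2 = 0)
    (hab1 : d + 2 * a ≤ b + 1) (hd2 : 2 ≤ d)
    (hks : 2 * ks + 2 * ((d + a % 2) / 2) = a + a % 2 + (b + b % 2)) (hT : T + a + 1 = ks + (d - d % 2) + 2 * (d % 2))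
    (hme : m₁ + a = m) (hjle : jl₁ + a = jl) (hCb : C + b = m + jl) (hbm : b ≤ m + a)
    (hmeq : m₁ = jl₁ - d + 1) (hdjl : d ≤ jl₁) :
    (C + m₁ - jl₁) / 2 + 1 ≤ (2 * m₁ + 1 - d) / 2 + 1 ∧
      m₁ + (jl₁ / 2 + d % 2) = (((C + m₁ - jl₁) / 2 + 1) + d + m₁ - m₁ / 2 - 2) + (((2 * m₁ + 1 - d) / 2 + 1) - ((C + m₁ - jl₁) / 2 + 1)) ∧
      ks + (m₁ + (jl₁ / 2 + d % 2)) = m + jl / 2 + (((2 * m₁ + 1 - d) / 2 + 1) - ((C + m₁ - jl₁) / 2 + 1)) ∧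
      ks + (m₁ + (d - 1 + d % 2)) = m + T := by
  rw [ha2] at hks
  obtain ⟨a2, rfl⟩ : ∃ a2, a = 2 * a2 + 1 := ⟨a / 2, by omega⟩
  obtain ⟨j2, rfl⟩ : ∃ j2, jl₁ = 2 * j2 + 1 := ⟨jl₁ / 2, by omega⟩
  subst hmeq
  rcases Nat.even_or_odd' d with ⟨d2, rfl | rfl⟩ <;> rcases Nat.even_or_odd' b with ⟨b2, rfl | rfl⟩
  · exact ⟨by omega, by omega, by omega, by omega⟩
  · exact ⟨by omega, by omega, by omega, by omega⟩
  · exact ⟨by omega, by omega, by omega, by omega⟩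
  · exact ⟨by omega, by omega, by omega, by omega⟩

/-! ## §2 The law identity on both lanes -/

/-- **THE CLOSING ARITHMETIC OF A GENERIC LEVEL PIECE, TYPE U, STANDARD LANE (`a` even):** at the scaled tokens `(m₁, jλ₁) = (m − a, jλ − a)` and the cutoff
`C = m + jλ − b`, under the general rule `2ks + 2⌊(d + a%2)∕2⌋ = a + a%2 + b + b%2`, `T + a = ks + (d − d%2)` and ★ T5s-U's realizability branches,
`(q − 1)·q^{ks}·V_U(m₁, jλ₁, C) = q^m·((q + 1)·q^{jλ∕2} − 2·q^T)` (`V_U` = ★ p860037 ∕ ★ p860069's even value).  The rows of record `sq_{m*}` ∕ `lev_{ℓ₀+1,m*}` (odd `d`) of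
★ p860134 are instances. [cite: Rogawski1990, §4.9 Prop. 4.9.1 (b) p. 55] [cite: Kottwitz1986BaseChangeUnits, §1 pp. 240–241] [cite: Flicker1998UnitaryFL, Prop. 7 p. 84] -/
theorem law_arith_unr_std (q : ℕ) {a b d ks T m jl m₁ jl₁ C : ℕ} (ha2 : a % 2 = 0) (hjl : jl % 2 = 0)
    (hab1 : d + 2 * a ≤ b + 1) (hd2 : 2 ≤ d)
    (hks : 2 * ks + 2 * ((d + a % 2) / 2) = a + a % 2 + (b + b % 2)) (hT : T + a = ks + (d - d % 2))
    (hme : m₁ + a = m) (hjle : jl₁ + a = jl) (hCb : C + b = m + jl) (hbm : b ≤ m + a)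
    (hreal : (m₁ % 2 = d % 2 ∧ 1 ≤ m₁ ∧ m₁ + d ≤ jl₁) ∨ (m₁ = jl₁ - d + 1 ∧ d ≤ jl₁)) :
    ((q : ℚ) - 1) * (q : ℚ) ^ ks *
      ((q : ℚ) ^ m₁ * ((1 + ((q : ℚ) + 1) * ∑ i ∈ range (jl₁ / 2), (q : ℚ) ^ i) - 2 * ∑ i ∈ range (d - d % 2), (q : ℚ) ^ i)
      - (if m₁ + d ≤ jl₁ ∧ (jl₁ - m₁ - d) % 2 = 0 then
          ((q : ℚ) + 1) * (q : ℚ) ^ (((C + m₁ - jl₁) / 2 + 1) + d + (jl₁ - m₁ - d) / 2 + m₁ / 2 - 1) *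
            ∑ i ∈ range (((2 * m₁ + 1 - d) / 2 + 1) - ((C + m₁ - jl₁) / 2 + 1)), (q : ℚ) ^ i
        else 0)
      - (if jl₁ + 1 = d + m₁ then
          ((q : ℚ) + 1) * (q : ℚ) ^ (((C + m₁ - jl₁) / 2 + 1) + d + m₁ - m₁ / 2 - 2) *
            ∑ i ∈ range (((2 * m₁ + 1 - d) / 2 + 1) - ((C + m₁ - jl₁) / 2 + 1)), (q : ℚ) ^ i
        else 0)) =
      (q : ℚ) ^ m * (((q : ℚ) + 1) * (q : ℚ) ^ (jl / 2) - 2 * (q : ℚ) ^ T) := by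
  rcases hreal with ⟨hpar, hm1, hmd⟩ | ⟨hmeq, hdjl⟩
  · have hj1 : (jl₁ - m₁ - d) % 2 = 0 := by omega
    have hn2 : ¬ (jl₁ + 1 = d + m₁) := by omega
    obtain ⟨-, h1, h2, h3⟩ := exponents_unr_std_one ha2 hjl hab1 hd2 hks hT hme hjle hCb hbm hpar hmd
    rw [if_pos ⟨hmd, hj1⟩, if_neg hn2, sub_zero]
    exact law_arith_unr (q : ℚ) (Or.inr h1) h2 h3
  · have hn1 : ¬ (m₁ + d ≤ jl₁ ∧ (jl₁ - m₁ - d) % 2 = 0) := fun h => by omega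
    have hy2 : jl₁ + 1 = d + m₁ := by omega
    obtain ⟨-, h1, h2, h3⟩ := exponents_unr_std_two ha2 hjl hab1 hd2 hks hT hme hjle hCb hbm hmeq hdjl
    rw [if_neg hn1, if_pos hy2, sub_zero]
    exact law_arith_unr (q : ℚ) (Or.inr h1) h2 h3

/-- **THE CLOSING ARITHMETIC OF A GENERIC LEVEL PIECE, TYPE U, FLIPPED LANE (`a` odd):** the same with ★ p860037 ∕ ★ p860069's flipped value and the rule
`T + a + 1 = ks + (d − d%2) + 2(d%2)`; rows of record `lev_{ℓ₀,m*}` (odd `d`) ∕ `lev_{ℓ₀+1,m*}` (even `d`) of ★ p860134 are instances.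
[cite: Rogawski1990, §4.9 Prop. 4.9.1 (b) p. 55] [cite: Kottwitz1986BaseChangeUnits, §1 pp. 240–241] [cite: Flicker1998UnitaryFL, Prop. 7 p. 84] -/
theorem law_arith_unr_flip (q : ℕ) {a b d ks T m jl m₁ jl₁ C : ℕ} (ha2 : a % 2 = 1) (hjl : jl % 2 = 0)
    (hab1 : d + 2 * a ≤ b + 1) (hd2 : 2 ≤ d)
    (hks : 2 * ks + 2 * ((d + a % 2) / 2) = a + a % 2 + (b + b % 2)) (hT : T + a + 1 = ks + (d - d % 2) + 2 * (d % 2))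
    (hme : m₁ + a = m) (hjle : jl₁ + a = jl) (hCb : C + b = m + jl) (hbm : b ≤ m + a)
    (hreal : (m₁ % 2 ≠ d % 2 ∧ 1 ≤ m₁ ∧ m₁ + d ≤ jl₁) ∨ (m₁ = jl₁ - d + 1 ∧ d ≤ jl₁)) :
    ((q : ℚ) - 1) * (q : ℚ) ^ ks *
      ((q : ℚ) ^ m₁ * ((1 + ((q : ℚ) + 1) * ∑ i ∈ range (jl₁ / 2 + d % 2), (q : ℚ) ^ i) - 2 * ∑ i ∈ range (d - 1 + d % 2), (q : ℚ) ^ i)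
      - (if m₁ + d ≤ jl₁ ∧ (jl₁ - m₁ - d) % 2 = 0 then
          ((q : ℚ) + 1) * (q : ℚ) ^ (((C + m₁ - jl₁) / 2 + 1) + d + (jl₁ - m₁ - d) / 2 + m₁ / 2 - 1) *
            ∑ i ∈ range (((2 * m₁ + 1 - d) / 2 + 1) - ((C + m₁ - jl₁) / 2 + 1)), (q : ℚ) ^ i
        else 0)
      - (if jl₁ + 1 = d + m₁ then
          ((q : ℚ) + 1) * (q : ℚ) ^ (((C + m₁ - jl₁) / 2 + 1) + d + m₁ - m₁ / 2 - 2) *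
            ∑ i ∈ range (((2 * m₁ + 1 - d) / 2 + 1) - ((C + m₁ - jl₁) / 2 + 1)), (q : ℚ) ^ i
        else 0)) =
      (q : ℚ) ^ m * (((q : ℚ) + 1) * (q : ℚ) ^ (jl / 2) - 2 * (q : ℚ) ^ T) := by
  rcases hreal with ⟨hpar, hm1, hmd⟩ | ⟨hmeq, hdjl⟩
  · have hj1 : (jl₁ - m₁ - d) % 2 = 0 := by omega
    have hn2 : ¬ (jl₁ + 1 = d + m₁) := by omega
    obtain ⟨-, h1, h2, h3⟩ := exponents_unr_flip_one ha2 hjl hab1 hd2 hks hT hme hjle hCb hbm hpar hmd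
    rw [if_pos ⟨hmd, hj1⟩, if_neg hn2, sub_zero]
    exact law_arith_unr (q : ℚ) (Or.inr h1) h2 h3
  · have hn1 : ¬ (m₁ + d ≤ jl₁ ∧ (jl₁ - m₁ - d) % 2 = 0) := fun h => by omega
    have hy2 : jl₁ + 1 = d + m₁ := by omega
    obtain ⟨-, h1, h2, h3⟩ := exponents_unr_flip_two ha2 hjl hab1 hd2 hks hT hme hjle hCb hbm hmeq hdjl
    rw [if_neg hn1, if_pos hy2, sub_zero]
    exact law_arith_unr (q : ℚ) (Or.inr h1) h2 h3

/-! ## §3 The `ℤ` bottom, inert shape -/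

/-- **THE LEVEL LAW'S CLOSING ARITHMETIC IN `ℤ`, INERT SHAPE** (type-U twin of ★ p860127 `levels_bottom_arith`).  From the weld `ε(A − A′) = W`, the law identity
`(q − 1)q^{ks}W = q^m((q + 1)q^P − 2q^T)` and the INERT H-side closed form `(q − 1)F + 2 = (q + 1)q^P`: `(q − 1)q^{ks}(A − A′) = ε·q^m·((q − 1)F + 2 − 2q^T)`.
[cite: Rogawski1990, §4.9 Prop. 4.9.1 (b) p. 55] [cite: LabesseLanglands1979, §2 pp. 8–10] -/
theorem levels_bottom_arith_inert {q m ks T F P A A' : ℕ} {ε : ℤ} {W : ℚ} (hε : ε = 1 ∨ ε = -1)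
    (hweld : (ε : ℚ) * (((A : ℕ) : ℚ) - ((A' : ℕ) : ℚ)) = W)
    (hlaw : ((q : ℚ) - 1) * (q : ℚ) ^ ks * W = (q : ℚ) ^ m * (((q : ℚ) + 1) * (q : ℚ) ^ P - 2 * (q : ℚ) ^ T))
    (hH : (q - 1) * F + 2 = (q + 1) * q ^ P) (hq : 1 ≤ q) :
    ((q : ℤ) - 1) * (q : ℤ) ^ ks * ((A : ℤ) - (A' : ℤ)) = ε * (q : ℤ) ^ m * (((q : ℤ) - 1) * (F : ℤ) + 2 - 2 * (q : ℤ) ^ T) := by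
  have hε2 : (ε : ℚ) * ε = 1 := by rcases hε with h | h <;> simp [h]
  have hHQ : ((q : ℚ) - 1) * (F : ℚ) + 2 = ((q : ℚ) + 1) * (q : ℚ) ^ P := by
    have h := congrArg (fun x : ℕ => (x : ℚ)) hH
    push_cast [Nat.cast_sub hq] at h
    exact h
  have key : ((q : ℚ) - 1) * (q : ℚ) ^ ks * ((A : ℚ) - (A' : ℚ)) = (ε : ℚ) * (q : ℚ) ^ m * (((q : ℚ) - 1) * (F : ℚ) + 2 - 2 * (q : ℚ) ^ T) := by
    have h1 : (A : ℚ) - (A' : ℚ) = (ε : ℚ) * W := by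
      rw [← hweld, ← mul_assoc, hε2, one_mul]
    rw [h1]
    linear_combination (ε : ℚ) * hlaw - (ε : ℚ) * (q : ℚ) ^ m * hHQ
  exact_mod_cast key

end Summit.HodgeConjecture.HodgeConjecture.Cruxes.H413.F0P3cDyRamLevelsCensusLawArithUnrGeneric
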